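import Literature.Analysis.FluidPDE.LerayHopfProofs
import Literature.Analysis.FluidPDE.LerayHopfTimeSlice
import Literature.Analysis.FluidPDE.SuitableWeak
import Literature.Analysis.FluidPDE.TaoEnstrophyLocalisationProofs
import Literature.Analysis.FluidPDE.WeakGradientIBP
import Literature.Analysis.FunctionSpaces.Mollification
import HarnessLib

/-!
# The weak spatial gradient of a Leray–Hopf solution as a space–time object

Analysis/FluidPDE support file in the decomposition of the endpoint criterion
`Literature.Analysis.FluidPDE.ess_endpoint` (Escauriaza–Seregin–Šverák 2003, Thm. 1.3; see `FluidPDE/NSLerayHopfProofs`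
and the forthcoming `FluidPDE/NSSuitableESS`). The local theorems of ESS (Thm. 1.4, Lemma 2.2)
are applied in §3 of
that paper to the restrictions of an `L_{3,∞}` Leray–Hopf solution to parabolic cylinders
`Q(z₀, R) ⊂ Q_T`; their hypothesis (1.15) `v ∈ L₂(-1, 0; W¹₂(B))` is a statement about the
**space–time** weak gradient `∇v` on the cylinder (accepted `Fluid.HasWeakSpatialGradientOn`:
integration by parts against space–time test functions, local integrability on the region, and
`∫∫ |∇v|² < ∞` as an integral over the cylinder).

The accepted Leray–Hopf class `Fluid.IsLerayHopfOn` (Leray 1934, §31; Galdi 2000, Def. 2.1)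
records the dissipation clause **slice-wise**: a map `G : ℝ → E → E →L[ℝ] E` with `G t` a weak
gradient of `u t` for a.e. `t ∈ (0, T)` and `∫₀ᵀ (∫ |G t|²) dt < ∞` as an *iterated* lower
integral. Nothing there makes `G` jointly measurable on `(0, T) × E` (the slices `G t` are
determined a.e., but the witness may be changed arbitrarily on a null set of times and is not
asserted measurable in `t`), so neither Tonelli nor the space–time integration by parts is
available for `G` itself. This file proves that a jointly measurable version always exists and
derives the space–time form of the dissipation clause:

* `Fluid.exists_stronglyMeasurable_of_sliced_weakGradient` — if `U : ℝ × E → F'` is strongly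
  measurable and `U(t, ·)` has the weak gradient `G t` for a.e. `t ∈ (0, T)`, then there is a
  strongly measurable `G'' : ℝ × E → E →L[ℝ] F'` with `G''(t, ·) = G t` a.e. for a.e. `t` (no
  integrability of `G` beyond the local integrability in the definition is needed);
* `Fluid.IsLerayHopfOn.exists_measurable_weakGradient` — for a Leray–Hopf solution the weak
  gradient may be taken jointly strongly measurable, with finite dissipation both as an iterated
  and as a space–time integral;
* `Fluid.IsLerayHopfOn.exists_hasWeakSpatialGradientOn` — **a Leray–Hopf solution has a
  square-integrable weak spatial gradient on the open strip `(0, T) × E`** in the sense of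
  `Fluid.HasWeakSpatialGradientOn (Fluid.slab E (Ioo 0 T) _)`; this is the membership
  `v ∈ L₂(0, T; W¹₂)` of ESS (1.3)/(1.15) in the form consumed by the (forthcoming) local
  hypotheses structure of ESS Thm. 1.4 on viscous cylinders.

## Proof

Mollify in space along the mollifier sequence `ρₙ` of `Literature.Analysis.FunctionSpaces.exists_contDiffBump_seq`. The
**mollified gradients** `Lₙ(t, x) = (∇ρₙ ⊛ U(t, ·))(x) = ∫ Dρₙ(x - y) ⊗ U(t, y) dy`
(`Fluid.mollifiedGradient`; this is Mathlib's derivative-convolution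
`Dρₙ ⋆[(lsmul ℝ ℝ).precompL E] U(t, ·)`, `mollifiedGradient_eq_convolution_precompL`) are jointly
strongly measurable in `(t, x)` (a Bochner integral of a strongly measurable kernel,
`StronglyMeasurable.integral_prod_right'`), and for every good `t` they equal `ρₙ ⋆ G t`
(mollification commutes with weak differentiation: the accepted
`HasWeakFDerivOn.integral_fderiv_comp_sub_smul`; Evans, *PDE*, §5.3.1, Thm. 1). Hence, for every
good `t`, the Lebesgue differentiation theorem (`Literature.Analysis.FunctionSpaces.ae_tendsto_normed_convolution`, `G t` being
locally integrable) gives `Lₙ(t, x) → G t x` for a.e. `x`, along the full sequence. The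
convergence set of the strongly measurable sequence `Lₙ` is measurable
(`StronglyMeasurable.measurableSet_exists_tendsto`), hence conull for the product measure
(`Measure.ae_prod_mem_iff_ae_ae_mem`), and the a.e. limit has a strongly measurable version
(`exists_stronglyMeasurable_limit_of_tendsto_ae`), which is `G''`; slice-wise it agrees with
`G t` by uniqueness of limits. For a Leray–Hopf solution one applies this to a strongly
measurable version of `uncurry u` on the strip; the space–time integration-by-parts identity is
the slice identity (`HasWeakGradient.integral_inner_fderiv_apply_test` with the test field
`φ(t, ·) w`) integrated in `t`.

## Mathlib search

Mathlib (this pin) has no weak derivatives and no Sobolev–Bochner spaces `L²(0, T; W^{1,2})`. In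
the tree, `D(ρ ⋆ v) = ρ ⋆ Dv` for weakly differentiable `v` is the accepted
`HasWeakFDerivOn.integral_fderiv_comp_sub_smul` / `HasWeakFDerivOn.fderiv_convolution_apply`
(`FunctionSpaces/Mollification.lean`), of which `mollifiedGradient_eq_convolution` is the
rank-one-kernel form; the mollified gradient itself is Mathlib's
`fderiv ℝ ρ ⋆[(lsmul ℝ ℝ).precompL E, volume] v` (the kernel of
`HasCompactSupport.hasFDerivAt_convolution_left`), `mollifiedGradient_eq_convolution_precompL`;
the pointwise bound `‖L‖ₑ² ≤ ofReal |L|²` is the accepted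
`Fluid.sq_enorm_le_ofReal_frobeniusNormSq` (`NSVorticityDifference.lean`, inlined here to keep the
import list small). The
measurable-selection ingredients used are `StronglyMeasurable.integral_prod_right'`,
`MeasureTheory.StronglyMeasurable.measurableSet_exists_tendsto`,
`exists_stronglyMeasurable_limit_of_tendsto_ae`, `Measure.ae_prod_mem_iff_ae_ae_mem`.

## References

* J. Leray, *Sur le mouvement d'un liquide visqueux emplissant l'espace*, Acta Math. 63 (1934),
  §31 (b) (the dissipation integral of a turbulent solution).
* L. Escauriaza, G. Seregin, V. Šverák, *`L_{3,∞}`-solutions of Navier–Stokes equations and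
  backward uniqueness*, Russ. Math. Surveys 58:2 (2003) 211–250, (1.3) and Thm. 1.4 (1.15)
  (`v ∈ L₂(0, T; W¹₂)`).
* L. C. Evans, *Partial Differential Equations*, 2nd ed. (2010), §5.3.1, Thm. 1
  (`D(η_ε ⋆ u) = η_ε ⋆ Du`) and App. C.4 (mollifiers).
-/

noncomputable section

open MeasureTheory TopologicalSpace Set Function Filter Topology ContinuousLinearMap Metric
open scoped InnerProductSpace RealInnerProductSpace ENNReal NNReal Convolution

namespace Literature.Analysis.FluidPDE

variable {E : Type*} [NormedAddCommGroup E] [InnerProductSpace ℝ E] [FiniteDimensional ℝ E]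
  [MeasurableSpace E] [BorelSpace E]
variable {F' : Type*} [NormedAddCommGroup F'] [InnerProductSpace ℝ F'] [FiniteDimensional ℝ F']

/-! ### Mollified gradients -/

section Mollified

/-- The **mollified gradient** of a field `v : E → F'` by a kernel `ρ`:
`(∇ρ ⊛ v)(x) = ∫ Dρ(x - y) ⊗ v(y) dy`, the rank-one maps `w ↦ Dρ(x - y)[w] v(y)` integrated in
`y`; for `ρ` a test function and `v` weakly differentiable this is `ρ ⋆ ∇v`
(`mollifiedGradient_eq_convolution`; Evans, *PDE*, §5.3.1, Thm. 1: `D(η_ε ⋆ u) = η_ε ⋆ Du`). [cite: Evans2010, §5.3.1 Thm. 1] -/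
def mollifiedGradient (ρ : E → ℝ) (v : E → F') (x : E) : E →L[ℝ] F' :=
  ∫ y, smulRightL ℝ E F' (fderiv ℝ ρ (x - y)) (v y)

omit [MeasurableSpace E] [BorelSpace E] [FiniteDimensional ℝ E] [FiniteDimensional ℝ F'] in
/-- Continuity of the rank-one kernel `(a, w) ↦ a ⊗ w`. [folklore] -/
theorem continuous_smulRightL_uncurry :
    Continuous fun q : (E →L[ℝ] ℝ) × F' => smulRightL ℝ E F' q.1 q.2 :=
  (smulRightL ℝ E F').continuous₂

omit [FiniteDimensional ℝ F'] in
/-- The integrand of the mollified gradient is integrable when `ρ` is `C¹` with compact support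
and `v` is locally integrable. [folklore] -/
theorem integrable_smulRightL_fderiv_comp_sub {ρ : E → ℝ} (hρ : ContDiff ℝ 1 ρ)
    (hρc : HasCompactSupport ρ) {v : E → F'} (hv : LocallyIntegrable v volume) (x : E) :
    Integrable (fun y => smulRightL ℝ E F' (fderiv ℝ ρ (x - y)) (v y)) volume := by
  have h1 : ConvolutionExistsAt (fderiv ℝ ρ) v x (smulRightL ℝ E F') volume :=
    (hρc.fderiv ℝ).convolutionExists_left _ (hρ.continuous_fderiv one_ne_zero) hv x
  have h2 := h1.integrable.comp_sub_left x
  simp only [sub_sub_cancel] at h2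
  exact h2

omit [FiniteDimensional ℝ F'] in
/-- Evaluation of the mollified gradient: `(∇ρ ⊛ v)(x) w = ∫ Dρ(x - y)[w] • v(y) dy`. [folklore] -/
theorem mollifiedGradient_apply {ρ : E → ℝ} (hρ : ContDiff ℝ 1 ρ) (hρc : HasCompactSupport ρ)
    {v : E → F'} (hv : LocallyIntegrable v volume) (x w : E) :
    mollifiedGradient ρ v x w = ∫ y, (fderiv ℝ ρ (x - y) w) • v y := by
  rw [mollifiedGradient, ContinuousLinearMap.integral_apply
    (integrable_smulRightL_fderiv_comp_sub hρ hρc hv x) w]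
  simp only [smulRightL_apply_apply, ContinuousLinearMap.smulRight_apply]

omit [FiniteDimensional ℝ F'] in
/-- The mollified gradient is Mathlib's derivative-convolution with the kernel
`(lsmul ℝ ℝ).precompL E` (the one of `HasCompactSupport.hasFDerivAt_convolution_left`:
`D(ρ ⋆ v) = Dρ ⋆[precompL] v`), up to the substitution `y ↦ x - y` in the integral; no
hypotheses on `ρ`, `v` are needed. [folklore] -/
theorem mollifiedGradient_eq_convolution_precompL (ρ : E → ℝ) (v : E → F') (x : E) :
    mollifiedGradient ρ v x =
      (fderiv ℝ ρ ⋆[(lsmul ℝ ℝ : ℝ →L[ℝ] F' →L[ℝ] F').precompL E, volume] v) x := by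
  rw [convolution_def, mollifiedGradient,
    ← integral_sub_left_eq_self (fun t =>
      ((lsmul ℝ ℝ : ℝ →L[ℝ] F' →L[ℝ] F').precompL E) (fderiv ℝ ρ t) (v (x - t))) volume x]
  simp only [sub_sub_cancel]
  congr 1 with y

omit [FiniteDimensional ℝ F'] in
/-- **The mollified gradient of a weakly differentiable field is the mollification of its weak
gradient**: `∇ρ ⊛ v = ρ ⋆ G` pointwise, for `ρ` a test function and `G` a weak gradient of `v`
(Evans, *PDE*, §5.3.1, Thm. 1 (i); the tree's `HasWeakFDerivOn.integral_fderiv_comp_sub_smul`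
supplies `∫ Dρ(x - y)[w] v(y) dy = ∫ ρ(x - y) G(y) w dy`). [cite: Evans2010, §5.3.1 Thm. 1] -/
theorem mollifiedGradient_eq_convolution {ρ : E → ℝ} (hρ : FunctionSpaces.IsTestFunctionOn (⊤ : Opens E) ρ)
    {v : E → F'} {G : E → E →L[ℝ] F'} (hG : HasWeakGradient v G) (x : E) :
    mollifiedGradient ρ v x = (ρ ⋆[lsmul ℝ ℝ, volume] G) x := by
  have hv : LocallyIntegrable v volume := locallyIntegrableOn_univ.1 (by
    simpa only [Opens.coe_top] using hG.locallyIntegrableOn)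
  have hGl : LocallyIntegrable G volume := locallyIntegrableOn_univ.1 (by
    simpa only [Opens.coe_top] using hG.locallyIntegrableOn_deriv)
  have hρ1 : ContDiff ℝ 1 ρ := hρ.contDiff.of_le (by exact_mod_cast le_top)
  have hint : ConvolutionExistsAt ρ G x (lsmul ℝ ℝ) volume :=
    hρ.hasCompactSupport.convolutionExists_left _ hρ.contDiff.continuous hGl x
  ext w
  rw [mollifiedGradient_apply hρ1 hρ.hasCompactSupport hv, convolution_def,
    ContinuousLinearMap.integral_apply hint.integrable w]
  simp only [lsmul_apply, FunLike.coe_smul, Pi.smul_apply]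
  rw [hG.integral_fderiv_comp_sub_smul hρ x w]
  rw [← integral_sub_left_eq_self (fun t => ρ t • G (x - t) w) volume x]
  simp only [sub_sub_cancel]

omit [FiniteDimensional ℝ F'] in
/-- **Joint measurability of mollified gradients of a jointly measurable family.** If
`U : ℝ × E → F'` is strongly measurable, then `(t, x) ↦ (∇ρ ⊛ U(t, ·))(x)` is strongly
measurable on `ℝ × E` (the Bochner integral of a strongly measurable kernel is strongly
measurable in the parameter, Mathlib `StronglyMeasurable.integral_prod_right'`). [folklore] -/
theorem stronglyMeasurable_mollifiedGradient {ρ : E → ℝ} (hρ : ContDiff ℝ 1 ρ)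
    {U : ℝ × E → F'} (hU : StronglyMeasurable U) :
    StronglyMeasurable fun z : ℝ × E => mollifiedGradient ρ (fun y => U (z.1, y)) z.2 := by
  unfold mollifiedGradient
  have hK : StronglyMeasurable fun q : (ℝ × E) × E =>
      smulRightL ℝ E F' (fderiv ℝ ρ (q.1.2 - q.2)) (U (q.1.1, q.2)) := by
    have hA : StronglyMeasurable fun q : (ℝ × E) × E => fderiv ℝ ρ (q.1.2 - q.2) :=
      ((hρ.continuous_fderiv one_ne_zero).comp (by fun_prop)).stronglyMeasurable
    have hB : StronglyMeasurable fun q : (ℝ × E) × E => U (q.1.1, q.2) :=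
      hU.comp_measurable (by fun_prop)
    exact continuous_smulRightL_uncurry.comp_stronglyMeasurable (hA.prodMk hB)
  exact hK.integral_prod_right'

end Mollified

/-! ### Slice-wise properties of the mollified gradients of a weakly differentiable field -/

section Slice

variable {v : E → F'} {G : E → E →L[ℝ] F'}

/-- `‖f‖_{L²}² = ∫⁻ ‖f‖ₑ²`. [folklore] -/
theorem eLpNorm_two_sq_eq_lintegral {α : Type*} {m : MeasurableSpace α} (μ : Measure α)
    {β : Type*} [NormedAddCommGroup β] (f : α → β) :
    eLpNorm f 2 μ ^ 2 = ∫⁻ x, ‖f x‖ₑ ^ 2 ∂μ := by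
  have h := eLpNorm_natCast_pow_eq_lintegral μ f (n := 2) two_ne_zero
  simpa only [Nat.cast_ofNat] using h

omit [FiniteDimensional ℝ F'] in
/-- A weak gradient is locally integrable. [folklore] -/
theorem HasWeakGradient.locallyIntegrable_grad (hG : HasWeakGradient v G) :
    LocallyIntegrable G volume :=
  locallyIntegrableOn_univ.1 (by simpa only [Opens.coe_top] using hG.locallyIntegrableOn_deriv)

/-- **Lebesgue points**: along a mollifier sequence the mollified gradients converge a.e. to the
weak gradient. [folklore] -/
theorem ae_tendsto_mollifiedGradient {φ : ℕ → ContDiffBump (0 : E)}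
    (hφ : Tendsto (fun n => (φ n).rOut) atTop (𝓝 0)) (h'φ : ∀ n, (φ n).rOut ≤ 2 * (φ n).rIn)
    (hG : HasWeakGradient v G) :
    ∀ᵐ x ∂(volume : Measure E),
      Tendsto (fun n => mollifiedGradient ((φ n).normed volume) v x) atTop (𝓝 (G x)) := by
  have h : ∀ n, mollifiedGradient ((φ n).normed volume) v =
      (φ n).normed volume ⋆[lsmul ℝ ℝ, volume] G := fun n =>
    funext fun x => mollifiedGradient_eq_convolution (FunctionSpaces.isTestFunctionOn_normed (φ n)) hG x
  simp_rw [h]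
  exact FunctionSpaces.ae_tendsto_normed_convolution hφ h'φ hG.locallyIntegrable_grad

end Slice

/-! ### The jointly measurable representative of a sliced weak gradient -/

section Construction

variable {T : ℝ} {U : ℝ × E → F'} {G : ℝ → E → E →L[ℝ] F'}

/-- **A sliced weak gradient has a jointly measurable representative.** Let `U : ℝ × E → F'` be
strongly measurable and suppose that for a.e. `t ∈ (0, T)` the slice `U(t, ·)` has the weak
gradient `G t` on the whole space (no joint measurability of `G` is assumed, and no
integrability beyond the local integrability in `HasWeakGradient` — these are the data of the
dissipation clause of the accepted `Fluid.IsLerayHopfOn`). Then there is a strongly measurable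
`G'' : ℝ × E → E →L[ℝ] F'` with `G''(t, ·) = G t` a.e., for a.e. `t ∈ (0, T)`. Construction:
the mollified gradients `Lₙ = ∇ρₙ ⊛ U(t, ·) = ρₙ ⋆ G t` along a mollifier sequence are jointly
measurable and converge to `G t x` for a.e. `x`, for every good `t` (Lebesgue differentiation);
the convergence set is measurable, hence conull on the strip, and the a.e. limit of a sequence
of strongly measurable maps has a strongly measurable version. [folklore] -/
theorem exists_stronglyMeasurable_of_sliced_weakGradient (hU : StronglyMeasurable U)
    (hG : ∀ᵐ t ∂(volume.restrict (Ioo 0 T)), HasWeakGradient (fun y => U (t, y)) (G t)) :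
    ∃ G'' : ℝ × E → E →L[ℝ] F', StronglyMeasurable G'' ∧
      ∀ᵐ t ∂(volume.restrict (Ioo 0 T)), (fun x => G'' (t, x)) =ᵐ[volume] G t := by
  obtain ⟨φ, hφ, h'φ⟩ := FunctionSpaces.exists_contDiffBump_seq (E := E)
  -- the mollified gradients, jointly measurable
  obtain ⟨L, hL⟩ : ∃ L : ℕ → ℝ × E → E →L[ℝ] F', ∀ n z,
      L n z = mollifiedGradient ((φ n).normed volume) (fun y => U (z.1, y)) z.2 :=
    ⟨_, fun _ _ => rfl⟩
  have hLfun : ∀ n,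
      L n = fun z => mollifiedGradient ((φ n).normed volume) (fun y => U (z.1, y)) z.2 :=
    fun n => funext (hL n)
  have hLmeas : ∀ n, StronglyMeasurable (L n) := fun n => by
    rw [hLfun]
    exact stronglyMeasurable_mollifiedGradient ((φ n).contDiff_normed (n := 1)) hU
  -- slice-wise a.e. convergence along the full sequence (Lebesgue differentiation)
  have hconv_ae : ∀ᵐ t ∂(volume.restrict (Ioo 0 T)), ∀ᵐ x ∂(volume : Measure E),
      Tendsto (fun n => L n (t, x)) atTop (𝓝 (G t x)) := by
    filter_upwards [hG] with t ht
    filter_upwards [ae_tendsto_mollifiedGradient hφ h'φ ht] with x hx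
    simpa only [hL] using hx
  -- the convergence set is measurable, hence conull on the strip
  have hconvset : MeasurableSet {z : ℝ × E | ∃ l, Tendsto (fun n => L n z) atTop (𝓝 l)} :=
    MeasureTheory.StronglyMeasurable.measurableSet_exists_tendsto hLmeas
  have hae_strip : ∀ᵐ z ∂((volume.restrict (Ioo 0 T)).prod (volume : Measure E)),
      ∃ l, Tendsto (fun n => L n z) atTop (𝓝 l) := by
    refine (Measure.ae_prod_mem_iff_ae_ae_mem hconvset).2 ?_
    filter_upwards [hconv_ae] with t ht
    filter_upwards [ht] with x hx
    exact ⟨G t x, hx⟩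
  -- the strongly measurable a.e. limit, identified slice-wise by uniqueness of limits
  obtain ⟨G'', hG''meas, hG''lim⟩ := exists_stronglyMeasurable_limit_of_tendsto_ae
    (fun n => (hLmeas n).aestronglyMeasurable) hae_strip
  refine ⟨G'', hG''meas, ?_⟩
  filter_upwards [hconv_ae, Measure.ae_ae_of_ae_prod hG''lim] with t h1 h2
  filter_upwards [h1, h2] with x hx1 hx2
  exact tendsto_nhds_unique hx2 hx1

end Construction

/-! ### Consequences for Leray–Hopf weak solutions -/

section Congr

variable {v v' : E → F'} {G G' : E → E →L[ℝ] F'}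

omit [FiniteDimensional ℝ F'] in
/-- Weak gradients are stable under a.e. modification of the field. [folklore] -/
theorem HasWeakGradient.congr_ae (h : HasWeakGradient v G) (hv : v' =ᵐ[volume] v) :
    HasWeakGradient v' G where
  locallyIntegrableOn := h.locallyIntegrableOn.congr (ae_restrict_of_ae hv.symm)
  locallyIntegrableOn_deriv := h.locallyIntegrableOn_deriv
  integral_fderiv_smul_eq φ w hφ := by
    rw [← h.integral_fderiv_smul_eq φ w hφ]
    refine integral_congr_ae ((ae_restrict_of_ae hv).mono fun x hx => ?_)
    simp only [hx]

omit [FiniteDimensional ℝ F'] in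
/-- Weak gradients are stable under a.e. modification of the gradient. [folklore] -/
theorem HasWeakGradient.congr_grad_ae (h : HasWeakGradient v G) (hG : G' =ᵐ[volume] G) :
    HasWeakGradient v G' where
  locallyIntegrableOn := h.locallyIntegrableOn
  locallyIntegrableOn_deriv := h.locallyIntegrableOn_deriv.congr (ae_restrict_of_ae hG.symm)
  integral_fderiv_smul_eq φ w hφ := by
    rw [h.integral_fderiv_smul_eq φ w hφ]
    congr 1
    refine integral_congr_ae ((ae_restrict_of_ae hG).mono fun x hx => ?_)
    simp only [hx]

end Congr

section LerayHopf

variable {T ν : ℝ} {f u : ℝ → E → E} {u₀ : E → E}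

/-- **Local integrability on the strip from local square integrability.** A field on
`(0, T) × E` which is a.e. strongly measurable there and square integrable on `(0, T) × K` for
every compact `K` is locally integrable on the open strip (every point has the neighbourhood
`(0, T) × B(x, 1)` of finite measure, on which `L² ⊂ L¹`). [folklore] -/
theorem locallyIntegrableOn_strip_of_sq {β : Type*} [NormedAddCommGroup β] {g : ℝ × E → β}
    (hmeas : AEStronglyMeasurable g (volume.restrict (Ioo 0 T ×ˢ (univ : Set E))))
    (hsq : ∀ K : Set E, IsCompact K → ∫⁻ z in Ioo 0 T ×ˢ K, ‖g z‖ₑ ^ 2 < ∞) :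
    LocallyIntegrableOn g (Ioo 0 T ×ˢ (univ : Set E)) volume := by
  intro z hz
  set U : Set (ℝ × E) := Ioo 0 T ×ˢ closedBall z.2 1 with hU
  have hUsub : U ⊆ Ioo 0 T ×ˢ (univ : Set E) := prod_mono Subset.rfl (subset_univ _)
  have hUmeas : MeasurableSet U := measurableSet_Ioo.prod measurableSet_closedBall
  have hUfin : volume U < ∞ := by
    refine lt_of_le_of_lt (measure_mono (prod_mono Ioo_subset_Icc_self Subset.rfl)) ?_
    exact (isCompact_Icc.prod (isCompact_closedBall z.2 1)).measure_lt_top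
  haveI : IsFiniteMeasure (volume.restrict U) := isFiniteMeasure_restrict.2 hUfin.ne
  refine ⟨U, ?_, ?_⟩
  · refine mem_nhdsWithin_of_mem_nhds (Filter.mem_of_superset
      ((isOpen_Ioo.prod Metric.isOpen_ball).mem_nhds ⟨hz.1, mem_ball_self one_pos⟩) ?_)
    exact prod_mono Subset.rfl ball_subset_closedBall
  · have h2 : MemLp g 2 (volume.restrict U) := by
      refine ⟨hmeas.mono_measure (Measure.restrict_mono hUsub le_rfl), ?_⟩
      have h := hsq (closedBall z.2 1) (isCompact_closedBall z.2 1)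
      have h' : eLpNorm g 2 (volume.restrict U) ^ 2 < ∞ := by
        rw [eLpNorm_two_sq_eq_lintegral]; exact h
      exact (ENNReal.pow_lt_top_iff.1 h').resolve_right two_ne_zero
    exact memLp_one_iff_integrable.1 (h2.mono_exponent (by norm_num))

/-- **The weak gradient of a Leray–Hopf solution has a jointly measurable version.** For a
Leray–Hopf weak solution `u` on `E × [0, T)` there is `G' : ℝ → E → E →L[ℝ] E`, jointly
strongly measurable, which is a weak gradient of `u t` for a.e. `t ∈ (0, T)` and has finite
dissipation `∫₀ᵀ ∫ |G'|² < ∞`, both as an iterated and as a space–time integral (the witness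
`G` of the accepted `IsLerayHopfOn.weakGrad_energy` is only slice-wise a weak gradient;
`exists_stronglyMeasurable_of_sliced_weakGradient` applied to a strongly measurable version of
`u` produces `G'` with `G' t = G t` a.e. for a.e. `t`; the two energy inequalities of
`weakGrad_energy` transfer to `G'` verbatim by `lintegral_congr_ae` and are not restated —
consumers needing them re-derive them from that a.e. equality). This is the membership
`u ∈ L²(0, T; W^{1,2})` of the Leray–Hopf class in its space–time form (Leray 1934, §31 (b);
Escauriaza–Seregin–Šverák 2003, (1.3): `v ∈ L₂(0, T; J̊¹₂)`). [folklore] -/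
theorem IsLerayHopfOn.exists_measurable_weakGradient (hu : IsLerayHopfOn T ν f u₀ u) :
    ∃ G' : ℝ → E → E →L[ℝ] E, StronglyMeasurable (uncurry G') ∧
      (∀ᵐ t ∂(volume.restrict (Ioo 0 T)), HasWeakGradient (u t) (G' t)) ∧
      (∫⁻ t in Ioo 0 T, ∫⁻ x, ENNReal.ofReal (frobeniusNormSq (G' t x)) < ∞) ∧
      ∫⁻ z in Ioo 0 T ×ˢ (univ : Set E), ENNReal.ofReal (frobeniusNormSq (G' z.1 z.2)) < ∞ := by
  obtain ⟨G, hG, hGint, -, -⟩ := hu.weakGrad_energy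
  have hmeas : AEStronglyMeasurable (uncurry u) (volume.restrict (Ioo 0 T ×ˢ (univ : Set E))) :=
    hu.weak.1
  set U : ℝ × E → E := hmeas.mk (uncurry u) with hUdef
  have hU : StronglyMeasurable U := hmeas.stronglyMeasurable_mk
  have hae : uncurry u =ᵐ[volume.restrict (Ioo 0 T ×ˢ (univ : Set E))] U := hmeas.ae_eq_mk
  rw [← restrict_prod_volume_eq T] at hae
  have hslice : ∀ᵐ t ∂(volume.restrict (Ioo 0 T)), (fun y => U (t, y)) =ᵐ[volume] u t := by
    filter_upwards [Measure.ae_ae_of_ae_prod hae] with t ht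
    filter_upwards [ht] with x hx
    exact hx.symm
  have hGU : ∀ᵐ t ∂(volume.restrict (Ioo 0 T)), HasWeakGradient (fun y => U (t, y)) (G t) := by
    filter_upwards [hG, hslice] with t ht hs
    exact ht.congr_ae hs
  obtain ⟨G'', hG''m, hG''ae⟩ := exists_stronglyMeasurable_of_sliced_weakGradient hU hGU
  refine ⟨fun t x => G'' (t, x), hG''m, ?_, ?_, ?_⟩
  · filter_upwards [hG, hG''ae] with t ht hae'
    exact ht.congr_grad_ae hae'
  · refine lt_of_le_of_lt (le_of_eq ?_) hGint
    refine lintegral_congr_ae (hG''ae.mono fun t ht => ?_)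
    exact lintegral_congr_ae (ht.mono fun x hx => by simp only [hx])
  · rw [← restrict_prod_volume_eq T]
    have hm : AEMeasurable (fun z : ℝ × E => ENNReal.ofReal (frobeniusNormSq (G'' z)))
        (((volume : Measure ℝ).restrict (Ioo 0 T)).prod (volume : Measure E)) :=
      (ENNReal.measurable_ofReal.comp (LerayHopfProofs.continuous_frobeniusNormSq.measurable.comp
        hG''m.measurable)).aemeasurable
    have e := lintegral_prod _ hm
    change ∫⁻ z, ENNReal.ofReal (frobeniusNormSq (G'' (z.1, z.2)))
      ∂(((volume : Measure ℝ).restrict (Ioo 0 T)).prod (volume : Measure E)) < ∞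
    simp only [Prod.mk.eta]
    rw [e]
    refine lt_of_le_of_lt (le_of_eq ?_) hGint
    refine lintegral_congr_ae (hG''ae.mono fun t ht => ?_)
    exact lintegral_congr_ae (ht.mono fun x hx => by simp only [hx])

omit [FiniteDimensional ℝ E] [MeasurableSpace E] [BorelSpace E] [FiniteDimensional ℝ F'] in
/-- The scalar test field `x ↦ φ(t, x) w` built from a slice of a space–time test function is a
test field on the whole space. [folklore] -/
theorem isTestFunctionOn_slice_smul_const {Q : Opens (ℝ × E)} {φ : ℝ → E → ℝ}
    (hφ : IsSpaceTimeTestOn Q φ) (t : ℝ) (w : F') :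
    FunctionSpaces.IsTestFunctionOn (⊤ : Opens E) fun x => φ t x • w := by
  refine ⟨(hφ.contDiff_slice t).smul contDiff_const, ?_, fun _ _ => trivial⟩
  exact (hφ.hasCompactSupport_slice t).smul_right (f' := fun _ : E => w)

/-- **Leray–Hopf solutions have a square-integrable weak spatial gradient on the open strip**
`(0, T) × E` in the sense of the accepted `Fluid.HasWeakSpatialGradientOn` (jointly measurable,
locally integrable, integration by parts against space–time test functions), with finite
dissipation. Real proof: the jointly measurable version `G'` of
`IsLerayHopfOn.exists_measurable_weakGradient`; the space–time identity is the slice-wise one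
(`HasWeakGradient.integral_inner_fderiv_apply_test` with the test field `φ(t, ·) w`) integrated
in `t`, the slices of a test function on the strip vanishing for `t ∉ (0, T)`. [folklore] -/
theorem IsLerayHopfOn.exists_hasWeakSpatialGradientOn (hu : IsLerayHopfOn T ν f u₀ u) :
    ∃ G' : ℝ → E → E →L[ℝ] E,
      HasWeakSpatialGradientOn (slab E (Ioo 0 T) isOpen_Ioo) u G' ∧
      (∀ᵐ t ∂(volume.restrict (Ioo 0 T)), HasWeakGradient (u t) (G' t)) ∧
      (∫⁻ z in Ioo 0 T ×ˢ (univ : Set E), ENNReal.ofReal (frobeniusNormSq (G' z.1 z.2)) < ∞) ∧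
      ∫⁻ t in Ioo 0 T, ∫⁻ x, ENNReal.ofReal (frobeniusNormSq (G' t x)) < ∞ := by
  obtain ⟨G', hG'm, hG', hint, hint'⟩ := hu.exists_measurable_weakGradient
  refine ⟨G', ⟨?_, ?_, ?_⟩, hG', hint', hint⟩
  · -- local integrability of `u` on the strip
    rw [coe_slab]
    exact locallyIntegrableOn_strip_of_sq hu.weak.1 hu.weak.2.1
  · -- local integrability of `G'` on the strip
    rw [coe_slab]
    refine locallyIntegrableOn_strip_of_sq hG'm.aestronglyMeasurable fun K _ => ?_
    refine lt_of_le_of_lt ?_ hint'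
    refine (lintegral_mono_set (prod_mono Subset.rfl (subset_univ K))).trans ?_
    refine lintegral_mono fun z => ?_
    -- `‖L‖ₑ² ≤ ofReal |L|²` (the accepted `Fluid.sq_enorm_le_ofReal_frobeniusNormSq`, inlined)
    rw [← ofReal_norm, ← ENNReal.ofReal_pow (norm_nonneg _)]
    exact ENNReal.ofReal_le_ofReal (sq_opNorm_le_frobeniusNormSq _)
  · -- the space–time integration-by-parts identity
    intro φ hφ v w
    have hI : ∀ᵐ t ∂(volume : Measure ℝ),
        ∫ x, fderiv ℝ (φ t) x v * ⟪u t x, w⟫ = -∫ x, φ t x * ⟪G' t x v, w⟫ := by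
      have h1 : ∀ᵐ t ∂(volume : Measure ℝ), t ∈ Ioo 0 T →
          ∫ x, fderiv ℝ (φ t) x v * ⟪u t x, w⟫ = -∫ x, φ t x * ⟪G' t x v, w⟫ := by
        rw [← ae_restrict_iff' measurableSet_Ioo]
        filter_upwards [hG'] with t ht
        have hW := isTestFunctionOn_slice_smul_const hφ t w
        have key := HasWeakGradient.integral_inner_fderiv_apply_test ht hW v
        have hd : ∀ x, fderiv ℝ (fun x => φ t x • w) x v = (fderiv ℝ (φ t) x v) • w := by
          intro x
          rw [fderiv_smul_const (((hφ.contDiff_slice t).differentiable (by simp)) x),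
            ContinuousLinearMap.smulRight_apply]
        have e1 : ∫ x, fderiv ℝ (φ t) x v * ⟪u t x, w⟫ =
            ∫ x, ⟪u t x, fderiv ℝ (fun x => φ t x • w) x v⟫ :=
          integral_congr_ae (Eventually.of_forall fun x => by
            simp only [hd, real_inner_smul_right])
        have e2 : ∫ x, ⟪G' t x v, (fun x => φ t x • w) x⟫ = ∫ x, φ t x * ⟪G' t x v, w⟫ :=
          integral_congr_ae (Eventually.of_forall fun x => by
            simp only [real_inner_smul_right])
        rw [e1, key, e2]
      filter_upwards [h1] with t ht
      by_cases htI : t ∈ Ioo 0 T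
      · exact ht htI
      · have h0 : φ t = 0 := hφ.slice_eq_zero htI
        simp [h0]
    calc ∫ t, ∫ x, fderiv ℝ (φ t) x v * ⟪u t x, w⟫
        = ∫ t, -∫ x, φ t x * ⟪G' t x v, w⟫ := integral_congr_ae hI
      _ = -∫ t, ∫ x, φ t x * ⟪G' t x v, w⟫ := integral_neg _

end LerayHopf

end Literature.Analysis.FluidPDE
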